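import Summits.Parity.GeneralizedHardyLittlewood.Theorems.LiouvilleShiftedTablesTypeI2DilatedMainTerms3
import Summits.Parity.GeneralizedHardyLittlewood.Theorems.LiouvilleShiftedTablesTypeI2DilatedMainTerms4
import Summits.Parity.GeneralizedHardyLittlewood.Theorems.LiouvilleShiftedTablesTypeI2DilatedMainTerms5

/-!
# Main terms of the line `peel-to-drappeau` (crux `TypeI2Dilated`, stmt-Parity-14272) — VI: ranges (ii), (iii) summed

Continues `…MainTerms2/3/4/5.lean`.  For a triple `τ = (P, (q, r))` (modulus `L_τ = lcm(q, rP)`) the reduced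
block `Φ_τ(e) = ∑_{p} ∑_{d} ω_τ(f, d) G(L_τ, e; p, d)` was split into three ranges.  Here:

* `range_iii_tau_le` — range (iii) (`d ≤ D₀ < `, `f > F₀`) of ONE triple summed over `d` with the heights
  `H_d = 2 + N/(d g)` (`g = (e, L)`): the critical term is `N (1 + log D₀)/φ(L)` (via `g φ(L/g) ≥ φ(L)`), the rest
  is uniform: `≤ 330000 W σ₀(L)² ℓ/F₀ · (D₀ (2 + E) + N (1 + log D₀)/φ(L))` with the bracket data
  `E = (H_m^{5/6} k_m + H_m^{1/2} k_m²)(1 + log H_m)`, `ℓ = log⁴(H_m k_m)`, `H_m = 2 + N`, `k_m = K X₂ ≥ K L`;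
* `range_ii_total_le` — range (ii) (`d ≤ D₀`, `f ≤ F₀`) summed over a whole family `T` of triples: each
  `G` is expanded over the classes `b mod f` (`MainTermsAux.norm_classSum_char_le_sum_classes`, one class
  `mod L_τ f` each), the sums over `τ` are moved inside, and an abstract family bound `hfam` (the shape of
  `family_bv`, multiplicity `τ(m)³` supplied by `MainTermsAux.card_filter_lcm_mul_eq_le`) is applied for each
  `(p, d, b)`: total `≤ F₀³ · W · (7 + 12 log D₀) · B_fam`.
[this line: Lines/peel-to-drappeau.md]
-/

noncomputable section

namespace Summit.Parity.GeneralizedHardyLittlewood.Cruxes.TypeI2Dilated.PeelToDrappeau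

open Finset Real Complex
open scoped ArithmeticFunction.sigma Classical
open Literature.NumberTheory.Sieve Literature.NumberTheory.Sieve.Drappeau2017 LiouvilleMV
open Literature.NumberTheory.LFunctions (crtProd)
open ArithmeticFunction (liouville)

/-! ### Small monotonicity facts -/

/-- `W(S/P) ≤ W(S)` for `P ≥ 1`. [this line] -/
theorem weightW_div_le {S : ℝ} {P : ℕ} (hP : 1 ≤ P) : weightW (S / P) ≤ weightW S := by
  unfold weightW
  have hP0 : (0 : ℝ) < P := by exact_mod_cast hP
  have hfl : ⌊S / P⌋₊ ≤ ⌊S⌋₊ := by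
    rcases le_or_gt 0 S with hS | hS
    · exact Nat.floor_le_floor (div_le_self hS (by exact_mod_cast hP))
    · rw [Nat.floor_of_nonpos (div_nonpos_of_nonpos_of_nonneg hS.le hP0.le)]; exact Nat.zero_le _
  rcases Nat.eq_zero_or_pos ⌊S / P⌋₊ with h0 | hpos
  · rw [h0, Nat.cast_zero, Real.log_zero]
    have := Real.log_natCast_nonneg ⌊S⌋₊
    linarith
  · have : Real.log (⌊S / P⌋₊ : ℝ) ≤ Real.log (⌊S⌋₊ : ℝ) :=
      Real.log_le_log (by exact_mod_cast hpos) (by exact_mod_cast hfl)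
    linarith

/-- `W(S) ≤ 7 + 12 log x` when `⌊S⌋ ≤ x`, `x ≥ 1`. [this line] -/
theorem weightW_le_of_le {S x : ℝ} (hx : 1 ≤ x) (hS : (⌊S⌋₊ : ℝ) ≤ x) : weightW S ≤ 7 + 12 * Real.log x := by
  unfold weightW
  rcases Nat.eq_zero_or_pos ⌊S⌋₊ with h0 | hpos
  · rw [h0, Nat.cast_zero, Real.log_zero]
    have := Real.log_nonneg hx
    linarith
  · have : Real.log (⌊S⌋₊ : ℝ) ≤ Real.log x := Real.log_le_log (by exact_mod_cast hpos) hS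
    linarith

/-- Uniform bound for the bracket: for `1 ≤ H ≤ H_m`, `1 ≤ k ≤ k_m`,
`𝔅(H, k) ≤ (H + (H_m^{5/6} k_m + H_m^{1/2} k_m²)(1 + log H_m)) log⁴(H_m k_m)`. [this line] -/
theorem mvBracket_le {H Hm k km : ℝ} (hH : 1 ≤ H) (hHm : H ≤ Hm) (hk : 1 ≤ k) (hkm : k ≤ km) :
    (H + (H ^ (5 / 6 : ℝ) * k + H ^ (1 / 2 : ℝ) * k ^ 2) * (1 + Real.log H)) * Real.log (H * k) ^ 4 ≤
      (H + (Hm ^ (5 / 6 : ℝ) * km + Hm ^ (1 / 2 : ℝ) * km ^ 2) * (1 + Real.log Hm)) *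
        Real.log (Hm * km) ^ 4 := by
  have hH0 : 0 < H := by linarith
  have hk0 : 0 < k := by linarith
  have hlogH : 0 ≤ Real.log H := Real.log_nonneg hH
  have hlogHm : Real.log H ≤ Real.log Hm := Real.log_le_log hH0 hHm
  have hlog : 0 ≤ Real.log (H * k) := Real.log_nonneg (one_le_mul_of_one_le_of_one_le hH hk)
  have hlogle : Real.log (H * k) ≤ Real.log (Hm * km) :=
    Real.log_le_log (mul_pos hH0 hk0) (mul_le_mul hHm hkm hk0.le (by linarith))
  have h1 : 0 ≤ 1 + Real.log Hm := by linarith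
  have hkm0 : 0 ≤ km := by linarith
  have hHm0 : 0 ≤ Hm := by linarith
  have hb0 : 0 ≤ H + (Hm ^ (5 / 6 : ℝ) * km + Hm ^ (1 / 2 : ℝ) * km ^ 2) * (1 + Real.log Hm) :=
    add_nonneg hH0.le (mul_nonneg (by positivity) h1)
  gcongr

/-- `∑_{d ≤ D₀} 1/d ≤ 1 + log D₀`. [folklore] -/
theorem sum_Icc_inv_le_one_add_log (D₀ : ℕ) : ∑ d ∈ Icc 1 D₀, (1 : ℝ) / d ≤ 1 + Real.log D₀ := by
  have h := sum_Ioc_inv_le_one_add_log D₀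
  rwa [show Ioc 0 D₀ = Icc 1 D₀ from rfl] at h

/-! ### Range (iii) of one triple, summed over `d ≤ D₀` -/

/-- **Range (iii) of one triple.**  Let `L ∣ q r̃`, `L ≤ X₂`, `F₀, K ≥ 1`, `e` a class mod `L`.  With `H_m = 2 + N`,
`k_m = K X₂`, `E = (H_m^{5/6} k_m + H_m^{1/2} k_m²)(1 + log H_m)`, `ℓ = log⁴(H_m k_m)`:
`∑_{d ≤ min(S, D₀)} ∑_{(f,ψ*): F₀ < f ≤ K} ω(f,d) G ≤ (330000 W(S) σ₀(L)² ℓ / F₀) (D₀ (2 + E) + N (1 + log D₀)/φ(L))`.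
[this line] -/
theorem range_iii_tau_le (c : ℤ) {q r L : ℕ} (hL : 0 < L) (hLqr : L ∣ q * r) (Slo S : ℝ) (e : ZMod L)
    {F₀ K X₂ : ℕ} (hF₀ : 0 < F₀) (hK : 1 ≤ K) (hLX : L ≤ X₂) (D₀ N : ℕ) :
    ∑ d ∈ (Icc 1 ⌊S⌋₊).filter (fun d => d ≤ D₀), ∑ p ∈ (primIndexLe K).filter (fun p => F₀ < p.1),
        omegaW c q r Slo S p.1 d * classCharNorm L e p d N ≤
      330000 * weightW S * (σ 0 L : ℝ) ^ 2 * Real.log ((2 + N : ℝ) * (K * X₂ : ℕ)) ^ 4 / F₀ *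
        (D₀ * (2 + (((2 + N : ℝ) ^ (5 / 6 : ℝ) * (K * X₂ : ℕ) + (2 + N : ℝ) ^ (1 / 2 : ℝ) *
            ((K * X₂ : ℕ) : ℝ) ^ 2) * (1 + Real.log (2 + N : ℝ)))) +
          N / Nat.totient L * (1 + Real.log D₀)) := by
  -- abbreviations
  set Hm : ℝ := 2 + N with hHm
  set E : ℝ := (Hm ^ (5 / 6 : ℝ) * (K * X₂ : ℕ) + Hm ^ (1 / 2 : ℝ) * ((K * X₂ : ℕ) : ℝ) ^ 2) *
    (1 + Real.log Hm) with hE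
  set ℓ : ℝ := Real.log (Hm * (K * X₂ : ℕ)) ^ 4 with hℓ
  set W := weightW S with hWdef
  have hW : 0 ≤ W := weightW_nonneg' S
  have hN0 : (0 : ℝ) ≤ N := Nat.cast_nonneg _
  have hHm2 : 2 ≤ Hm := by simp only [hHm]; linarith
  have hHm1 : 1 ≤ Hm := by linarith
  have hX₂ : 1 ≤ X₂ := hL.trans_le' le_rfl |>.trans_le hLX
  have hkm1 : (1 : ℝ) ≤ (K * X₂ : ℕ) := by exact_mod_cast Nat.mul_pos hK hX₂
  have hlogHm : 0 ≤ Real.log Hm := Real.log_nonneg hHm1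
  have hE0 : 0 ≤ E := by simp only [hE]; positivity
  have hℓ0 : 0 ≤ ℓ := by
    simp only [hℓ]
    exact pow_nonneg (Real.log_nonneg (one_le_mul_of_one_le_of_one_le hHm1 hkm1)) 4
  have hφL : (0 : ℝ) < Nat.totient L := by exact_mod_cast Nat.totient_pos.2 hL
  have hσL : (1 : ℝ) ≤ σ 0 L := by
    exact_mod_cast Nat.one_le_iff_ne_zero.2 (by
      rw [ArithmeticFunction.sigma_zero_apply]; exact (Finset.card_pos.2 ⟨1, Nat.one_mem_divisors.2 hL.ne'⟩).ne')
  have hF₀0 : (0 : ℝ) < F₀ := by exact_mod_cast hF₀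
  set Cst : ℝ := 330000 * W * (σ 0 L : ℝ) ^ 2 * ℓ / F₀ with hCst
  have hCst0 : 0 ≤ Cst := by simp only [hCst]; positivity
  -- per `d`
  have hd_bound : ∀ d ∈ (Icc 1 ⌊S⌋₊).filter (fun d => d ≤ D₀),
      ∑ p ∈ (primIndexLe K).filter (fun p => F₀ < p.1), omegaW c q r Slo S p.1 d * classCharNorm L e p d N ≤
        Cst * (2 + E + N / Nat.totient L * ((1 : ℝ) / d)) := by
    intro d hd
    have hd1 : 1 ≤ d := (mem_Icc.1 (mem_filter.1 hd).1).1
    have hd0 : (0 : ℝ) < d := by exact_mod_cast hd1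
    by_cases hcop : d.Coprime (q * r)
    · set g := Nat.gcd e.val L with hg
      have hg0 : 0 < g := Nat.gcd_pos_of_pos_right _ hL
      have hgL : g ∣ L := Nat.gcd_dvd_right _ _
      have hL' : 0 < L / g := Nat.div_pos (Nat.le_of_dvd hL hgL) hg0
      have hL'L : L / g ≤ L := Nat.div_le_self _ _
      set Hd : ℝ := 2 + ((N / d / g : ℕ) : ℝ) with hHd
      have hHd2 : 2 ≤ Hd := by simp only [hHd]; linarith [(Nat.cast_nonneg (N / d / g) : (0 : ℝ) ≤ _)]
      have hHdN : ((N / d / g : ℕ) : ℝ) ≤ Hd := by simp only [hHd]; linarith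
      have hmain := range_iii_d_le c hL hLqr Slo S e hcop hF₀ hK N hHd2 hHdN
      -- uniformise the bracket
      have hNdg : ((N / d / g : ℕ) : ℝ) ≤ N := by exact_mod_cast (Nat.div_le_self _ _).trans (Nat.div_le_self _ _)
      have hHdHm : Hd ≤ Hm := by simp only [hHd, hHm]; linarith
      have hk1 : (1 : ℝ) ≤ (K * (L / g) : ℕ) := by exact_mod_cast Nat.mul_pos hK hL'
      have hkkm : ((K * (L / g) : ℕ) : ℝ) ≤ (K * X₂ : ℕ) := by
        exact_mod_cast Nat.mul_le_mul_left K (hL'L.trans hLX)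
      have hB := mvBracket_le (by linarith : (1 : ℝ) ≤ Hd) hHdHm hk1 hkkm
      have hBd0 := mvBracket_nonneg (by linarith : (1 : ℝ) ≤ Hd) hk1
      -- `σ₀(L') ≤ σ₀(L)`, `φ(L') ≥ 1`, `g φ(L') ≥ φ(L)`
      have hσ : (σ 0 (L / g) : ℝ) ≤ σ 0 L := MainTermsAux.sigma_zero_le_of_dvd (Nat.div_dvd_of_dvd hgL) hL.ne'
      have hφL' : (0 : ℝ) < Nat.totient (L / g) := by exact_mod_cast Nat.totient_pos.2 hL'
      have hφL'1 : (1 : ℝ) ≤ Nat.totient (L / g) := by exact_mod_cast Nat.totient_pos.2 hL'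
      have hgφ : (Nat.totient L : ℝ) ≤ g * Nat.totient (L / g) := by
        have := MainTermsAux.totient_mul_le_mul_totient g (L / g)
        rw [Nat.mul_div_cancel' hgL] at this
        exact_mod_cast this
      -- the class-size term: `(N/d/g)/φ(L') ≤ N/(φ(L) d)`
      have hcls : ((N / d / g : ℕ) : ℝ) / Nat.totient (L / g) ≤ N / Nat.totient L * (1 / d) := by
        have h1 : ((N / d / g : ℕ) : ℝ) * g ≤ (N / d : ℕ) := by exact_mod_cast Nat.div_mul_le_self _ _
        have h2 : ((N / d : ℕ) : ℝ) * d ≤ N := by exact_mod_cast Nat.div_mul_le_self _ _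
        have hg0' : (0 : ℝ) < g := by exact_mod_cast hg0
        rw [div_le_iff₀ hφL', mul_one_div, div_mul_eq_mul_div, le_div_iff₀ hd0, div_mul_eq_mul_div,
          le_div_iff₀ hφL]
        calc ((N / d / g : ℕ) : ℝ) * d * Nat.totient L
            ≤ ((N / d / g : ℕ) : ℝ) * d * (g * Nat.totient (L / g)) := by gcongr
          _ = (((N / d / g : ℕ) : ℝ) * g) * d * Nat.totient (L / g) := by ring
          _ ≤ ((N / d : ℕ) : ℝ) * d * Nat.totient (L / g) := by gcongr
          _ ≤ N * Nat.totient (L / g) := by gcongr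
          _ = N * Nat.totient (L / g) := rfl
      refine hmain.trans ?_
      calc W / Nat.totient (L / g) * (σ 0 (L / g) : ℝ) ^ 2 * (330000 / F₀) *
            ((Hd + (Hd ^ (5 / 6 : ℝ) * (K * (L / g) : ℕ) + Hd ^ (1 / 2 : ℝ) * ((K * (L / g) : ℕ) : ℝ) ^ 2) *
              (1 + Real.log Hd)) * Real.log (Hd * (K * (L / g) : ℕ)) ^ 4)
          ≤ W / Nat.totient (L / g) * (σ 0 L : ℝ) ^ 2 * (330000 / F₀) * ((Hd + E) * ℓ) := by
            simp only [hE, hℓ] at hB ⊢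
            gcongr
        _ = Cst * ((Hd + E) / Nat.totient (L / g)) := by
            simp only [hCst]; field_simp
        _ ≤ Cst * (2 + E + N / Nat.totient L * (1 / d)) := by
            refine mul_le_mul_of_nonneg_left ?_ hCst0
            simp only [hHd, add_div]
            have h2 : (2 : ℝ) / Nat.totient (L / g) ≤ 2 := div_le_self (by norm_num) hφL'1
            have hE' : E / Nat.totient (L / g) ≤ E := div_le_self hE0 hφL'1
            linarith [hcls]
    · -- `(d, q r̃) ≠ 1`: every weight vanishes
      have h0 : ∑ p ∈ (primIndexLe K).filter (fun p => F₀ < p.1),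
          omegaW c q r Slo S p.1 d * classCharNorm L e p d N = 0 := by
        refine sum_eq_zero fun p _ => ?_
        rw [omegaW_eq_zero_of_not_coprime c Slo S p.1 hcop, zero_mul]
      rw [h0]
      exact mul_nonneg hCst0 (by positivity)
  refine (sum_le_sum hd_bound).trans ?_
  -- sum over `d ≤ D₀`
  have hsub : (Icc 1 ⌊S⌋₊).filter (fun d => d ≤ D₀) ⊆ Icc 1 D₀ := by
    intro d hd
    rw [mem_filter, mem_Icc] at hd
    exact mem_Icc.2 ⟨hd.1.1, hd.2⟩
  refine (sum_le_sum_of_subset_of_nonneg hsub fun d _ _ => mul_nonneg hCst0 (by positivity)).trans ?_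
  rw [← mul_sum, sum_add_distrib, sum_const, Nat.card_Icc, add_tsub_cancel_right, nsmul_eq_mul, ← mul_sum]
  refine mul_le_mul_of_nonneg_left ?_ hCst0
  have hharm := sum_Icc_inv_le_one_add_log D₀
  have hNφ : 0 ≤ (N : ℝ) / Nat.totient L := by positivity
  nlinarith [mul_le_mul_of_nonneg_left hharm hNφ]

/-! ### Range (ii), summed over a family of triples -/

/-- **Range (ii), one term, expanded over classes.**  For a triple `τ = (P, (q, r))` (modulus
`L_τ = lcm(q, rP)`), a pair `p = (f, ψ*)` with `f ≥ 1` and `d ≥ 1` there are classes `z_b mod L_τ f` with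
`ω_τ(f, d) G(L_τ, e; p, d) ≤ (W/φ(d)) ∑_{b < f} |∑_{t ≤ N/d, t ≡ z_b (L_τ f)} λ(t)|` (when `(d f, q rP) = 1` this
is `MainTermsAux.norm_classSum_char_le_sum_classes` and `ω ≤ W(S/P)/φ(d) ≤ W/φ(d)`; otherwise `ω = 0`).
[this line] -/
theorem range_ii_key (c : ℤ) (Slo S : ℝ) (N F₀ : ℕ) (T : Finset (ℕ × ℕ × ℕ))
    (hT : ∀ τ ∈ T, 0 < τ.1 ∧ 0 < τ.2.1 ∧ 0 < τ.2.2)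
    (e : (τ : ℕ × ℕ × ℕ) → ZMod (Nat.lcm τ.2.1 (τ.2.2 * τ.1))) {W : ℝ} (hW : 0 ≤ W)
    (hWτ : ∀ τ ∈ T, weightW (S / τ.1) ≤ W) :
    ∀ τ ∈ T, ∀ p ∈ primIndexLe F₀, ∀ d : ℕ, 0 < d → ∃ z : ℕ → ℕ,
      omegaW c τ.2.1 (τ.2.2 * τ.1) (Slo / τ.1) (S / τ.1) p.1 d *
          classCharNorm (Nat.lcm τ.2.1 (τ.2.2 * τ.1)) (e τ) p d N ≤
        W / Nat.totient d * ∑ b ∈ range p.1,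
          |∑ t ∈ (Icc 1 (N / d)).filter (fun t : ℕ =>
              (t : ZMod (Nat.lcm τ.2.1 (τ.2.2 * τ.1) * p.1)) =
                ((z b : ℕ) : ZMod (Nat.lcm τ.2.1 (τ.2.2 * τ.1) * p.1))), (liouville t : ℝ)| := by
  intro τ hτ p hp d hd
  obtain ⟨hP, hq, hr⟩ := hT τ hτ
  have hf : 0 < p.1 := (mem_primIndexLe.1 hp).1
  have hL : 0 < Nat.lcm τ.2.1 (τ.2.2 * τ.1) := Nat.lcm_pos hq (Nat.mul_pos hr hP)
  have hφd : (0 : ℝ) < Nat.totient d := by exact_mod_cast Nat.totient_pos.2 hd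
  have hωle : omegaW c τ.2.1 (τ.2.2 * τ.1) (Slo / τ.1) (S / τ.1) p.1 d ≤ W / Nat.totient d :=
    (omegaW_le_div_totient_right c _ _ _ _ p.1 hd).trans
      (div_le_div_of_nonneg_right (hWτ τ hτ) hφd.le)
  by_cases hcop : d.Coprime (τ.2.1 * (τ.2.2 * τ.1)) ∧ p.1.Coprime (τ.2.1 * (τ.2.2 * τ.1))
  · have hdL : d.Coprime (Nat.lcm τ.2.1 (τ.2.2 * τ.1)) :=
      Nat.Coprime.coprime_dvd_right (Nat.lcm_dvd_mul _ _) hcop.1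
    have hfL : p.1.Coprime (Nat.lcm τ.2.1 (τ.2.2 * τ.1)) :=
      Nat.Coprime.coprime_dvd_right (Nat.lcm_dvd_mul _ _) hcop.2
    obtain ⟨z, hz⟩ := MainTermsAux.norm_classSum_char_le_sum_classes hL hdL (e τ) hf hfL p.2 (N / d)
    refine ⟨z, ?_⟩
    unfold classCharNorm
    refine (mul_le_mul_of_nonneg_left hz (omegaW_nonneg _ _ _ _ _ _ _)).trans ?_
    exact mul_le_mul_of_nonneg_right hωle (sum_nonneg fun b _ => abs_nonneg _)
  · refine ⟨fun _ => 0, ?_⟩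
    have h0 : omegaW c τ.2.1 (τ.2.2 * τ.1) (Slo / τ.1) (S / τ.1) p.1 d = 0 := by
      rcases not_and_or.1 hcop with h | h
      · exact omegaW_eq_zero_of_not_coprime c _ _ p.1 h
      · exact omegaW_eq_zero_of_not_coprime_left c _ _ d h
    rw [h0, zero_mul]
    exact mul_nonneg (div_nonneg hW hφd.le) (sum_nonneg fun b _ => abs_nonneg _)

/-- **Range (ii), summed over a family of triples.**  Let `T` be a finite family of triples `τ = (P, (q, r))`
with positive coordinates, `e_τ` classes mod `L_τ = lcm(q, rP)`, `W ≥ W(S/P)` on `T`, and suppose the family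
bound `hfam` (the shape of `family_bv`: moduli `≤ X^{1/4}`, heights `≤ X`, multiplicity `τ(m)³`) with value
`B`.  If `N ≤ X` and `L_τ F₀ ≤ X^{1/4}` on `T`, then
`∑_{τ ∈ T} ∑_{(f,ψ*): f ≤ F₀} ∑_{d ≤ min(S/P, D₀)} ω_τ(f,d) G(L_τ, e_τ; (f,ψ*), d) ≤ F₀³ W (7 + 12 log D₀) B`.
[this line] -/
theorem range_ii_total_le (c : ℤ) (Slo S : ℝ) (N F₀ K D₀ : ℕ) (T : Finset (ℕ × ℕ × ℕ))
    (hT : ∀ τ ∈ T, 0 < τ.1 ∧ 0 < τ.2.1 ∧ 0 < τ.2.2)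
    (e : (τ : ℕ × ℕ × ℕ) → ZMod (Nat.lcm τ.2.1 (τ.2.2 * τ.1))) {W : ℝ} (hW : 0 ≤ W)
    (hWτ : ∀ τ ∈ T, weightW (S / τ.1) ≤ W) {X B : ℝ} (hB : 0 ≤ B) (hNX : (N : ℝ) ≤ X)
    (hMX : ∀ τ ∈ T, ((Nat.lcm τ.2.1 (τ.2.2 * τ.1) * F₀ : ℕ) : ℝ) ≤ X ^ (1 / 4 : ℝ))
    (hfam : ∀ (M z H : ℕ × ℕ × ℕ → ℕ),
      (∀ τ ∈ T, 1 ≤ M τ ∧ (M τ : ℝ) ≤ X ^ (1 / 4 : ℝ) ∧ (H τ : ℝ) ≤ X) →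
      (∀ m : ℕ, ((T.filter (fun τ => M τ = m)).card : ℝ) ≤ (σ 0 m : ℝ) ^ 3) →
        ∑ τ ∈ T, |∑ t ∈ (Icc 1 (H τ)).filter (fun t : ℕ => (t : ZMod (M τ)) = ((z τ : ℕ) : ZMod (M τ))),
          (liouville t : ℝ)| ≤ B) :
    ∑ τ ∈ T, ∑ p ∈ (primIndexLe K).filter (fun p => p.1 ≤ F₀),
        ∑ d ∈ (Icc 1 ⌊S / τ.1⌋₊).filter (fun d => d ≤ D₀),
          omegaW c τ.2.1 (τ.2.2 * τ.1) (Slo / τ.1) (S / τ.1) p.1 d *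
            classCharNorm (Nat.lcm τ.2.1 (τ.2.2 * τ.1)) (e τ) p d N ≤
      (F₀ : ℝ) ^ 3 * W * (7 + 12 * Real.log D₀) * B := by
  choose! Z hZ using range_ii_key c Slo S N F₀ T hT e hW hWτ
  -- the class sums, as a function of `(p, d, b, τ)`
  set CS : (Σ f : ℕ, DirichletCharacter ℂ f) → ℕ → ℕ → (ℕ × ℕ × ℕ) → ℝ := fun p d b τ =>
    |∑ t ∈ (Icc 1 (N / d)).filter (fun t : ℕ =>
        (t : ZMod (Nat.lcm τ.2.1 (τ.2.2 * τ.1) * p.1)) =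
          ((Z τ p d b : ℕ) : ZMod (Nat.lcm τ.2.1 (τ.2.2 * τ.1) * p.1))), (liouville t : ℝ)| with hCS
  -- Step 1: pointwise expansion and enlarging the index sets
  have hstep1 : ∀ τ ∈ T, ∑ p ∈ (primIndexLe K).filter (fun p => p.1 ≤ F₀),
      ∑ d ∈ (Icc 1 ⌊S / τ.1⌋₊).filter (fun d => d ≤ D₀),
        omegaW c τ.2.1 (τ.2.2 * τ.1) (Slo / τ.1) (S / τ.1) p.1 d *
          classCharNorm (Nat.lcm τ.2.1 (τ.2.2 * τ.1)) (e τ) p d N ≤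
      ∑ p ∈ primIndexLe F₀, ∑ d ∈ Icc 1 D₀, W / Nat.totient d * ∑ b ∈ range p.1, CS p d b τ := by
    intro τ hτ
    have hsubp : (primIndexLe K).filter (fun p => p.1 ≤ F₀) ⊆ primIndexLe F₀ := by
      intro p hp
      rw [mem_filter, mem_primIndexLe] at hp
      exact mem_primIndexLe.2 ⟨hp.1.1, hp.2, hp.1.2.2⟩
    have hsubd : (Icc 1 ⌊S / τ.1⌋₊).filter (fun d => d ≤ D₀) ⊆ Icc 1 D₀ := by
      intro d hd
      rw [mem_filter, mem_Icc] at hd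
      exact mem_Icc.2 ⟨hd.1.1, hd.2⟩
    refine (sum_le_sum_of_subset_of_nonneg hsubp fun p _ _ => sum_nonneg fun d _ =>
      mul_nonneg (omegaW_nonneg _ _ _ _ _ _ _) (classCharNorm_nonneg _ _ _ _ _)).trans ?_
    refine sum_le_sum fun p hp => ?_
    refine (sum_le_sum_of_subset_of_nonneg hsubd fun d _ _ =>
      mul_nonneg (omegaW_nonneg _ _ _ _ _ _ _) (classCharNorm_nonneg _ _ _ _ _)).trans ?_
    refine sum_le_sum fun d hd => ?_
    have hd0 : 0 < d := (mem_Icc.1 hd).1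
    simpa only [hCS] using hZ τ hτ p hp d hd0
  refine (sum_le_sum hstep1).trans ?_
  -- Step 2: move the sum over `τ` inside
  rw [sum_comm]
  have hswap : ∀ p ∈ primIndexLe F₀,
      ∑ τ ∈ T, ∑ d ∈ Icc 1 D₀, W / Nat.totient d * ∑ b ∈ range p.1, CS p d b τ =
        ∑ d ∈ Icc 1 D₀, W / Nat.totient d * ∑ b ∈ range p.1, ∑ τ ∈ T, CS p d b τ := by
    intro p _
    rw [sum_comm]
    refine sum_congr rfl fun d _ => ?_
    rw [← mul_sum, sum_comm]
  rw [sum_congr rfl hswap]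
  -- Step 3: the family bound for each `(p, d, b)`
  have hfam' : ∀ p ∈ primIndexLe F₀, ∀ d ∈ Icc 1 D₀, ∀ b : ℕ, ∑ τ ∈ T, CS p d b τ ≤ B := by
    intro p hp d hd b
    have hf : 0 < p.1 := (mem_primIndexLe.1 hp).1
    have hfF₀ : p.1 ≤ F₀ := (mem_primIndexLe.1 hp).2.1
    have h := hfam (fun τ => Nat.lcm τ.2.1 (τ.2.2 * τ.1) * p.1) (fun τ => Z τ p d b) (fun _ => N / d)
      ?_ ?_
    · simpa only [hCS] using h
    · intro τ hτ
      obtain ⟨hP, hq, hr⟩ := hT τ hτ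
      have hL : 0 < Nat.lcm τ.2.1 (τ.2.2 * τ.1) := Nat.lcm_pos hq (Nat.mul_pos hr hP)
      refine ⟨Nat.mul_pos hL hf, ?_, ?_⟩
      · refine le_trans ?_ (hMX τ hτ)
        exact_mod_cast Nat.mul_le_mul_left _ hfF₀
      · exact le_trans (by exact_mod_cast Nat.div_le_self N d) hNX
    · intro m
      exact MainTermsAux.card_filter_lcm_mul_eq_le T hT hf m
  -- Step 4: count
  have hφsum : ∑ d ∈ Icc 1 D₀, ((Nat.totient d : ℝ))⁻¹ ≤ 7 + 12 * Real.log D₀ := by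
    have h := Literature.NumberTheory.LFunctions.Montgomery.sum_Icc_inv_totient_le D₀
    simp_rw [one_div] at h
    exact h
  have hlogD : 0 ≤ 7 + 12 * Real.log (D₀ : ℝ) := by
    have := Real.log_natCast_nonneg D₀; linarith
  have hinner : ∀ p ∈ primIndexLe F₀,
      ∑ d ∈ Icc 1 D₀, W / Nat.totient d * ∑ b ∈ range p.1, ∑ τ ∈ T, CS p d b τ ≤
        W * (7 + 12 * Real.log D₀) * (F₀ * B) := by
    intro p hp
    have hfF₀ : (p.1 : ℝ) ≤ F₀ := by exact_mod_cast (mem_primIndexLe.1 hp).2.1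
    calc ∑ d ∈ Icc 1 D₀, W / Nat.totient d * ∑ b ∈ range p.1, ∑ τ ∈ T, CS p d b τ
        ≤ ∑ d ∈ Icc 1 D₀, W / Nat.totient d * (F₀ * B) := by
          refine sum_le_sum fun d hd => ?_
          refine mul_le_mul_of_nonneg_left ?_ (div_nonneg hW (Nat.cast_nonneg _))
          calc ∑ b ∈ range p.1, ∑ τ ∈ T, CS p d b τ ≤ ∑ b ∈ range p.1, B :=
                sum_le_sum fun b _ => hfam' p hp d hd b
            _ = p.1 * B := by rw [sum_const, card_range, nsmul_eq_mul]
            _ ≤ F₀ * B := mul_le_mul_of_nonneg_right hfF₀ hB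
      _ = (W * ∑ d ∈ Icc 1 D₀, ((Nat.totient d : ℝ))⁻¹) * (F₀ * B) := by
          rw [mul_sum, sum_mul]
          refine sum_congr rfl fun d _ => ?_
          rw [div_eq_mul_inv]
      _ ≤ W * (7 + 12 * Real.log D₀) * (F₀ * B) := by
          refine mul_le_mul_of_nonneg_right (mul_le_mul_of_nonneg_left hφsum hW) ?_
          positivity
  refine (sum_le_sum hinner).trans ?_
  rw [sum_const, nsmul_eq_mul]
  have hcard := MainTermsAux.card_primIndexLe_le F₀
  have hX0 : 0 ≤ W * (7 + 12 * Real.log D₀) * (F₀ * B) := by positivity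
  calc ((primIndexLe F₀).card : ℝ) * (W * (7 + 12 * Real.log D₀) * (F₀ * B))
      ≤ (F₀ : ℝ) ^ 2 * (W * (7 + 12 * Real.log D₀) * (F₀ * B)) := mul_le_mul_of_nonneg_right hcard hX0
    _ = (F₀ : ℝ) ^ 3 * W * (7 + 12 * Real.log D₀) * B := by ring

/-- Landing anchor of the main-terms chain, file 6; registered stub `mainTermsChain6_anchor`. -/
theorem mainTermsChain6_anchor : True := trivial

end Summit.Parity.GeneralizedHardyLittlewood.Cruxes.TypeI2Dilated.PeelToDrappeau

end
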